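import Summits.BirchSwinnertonDyer.BirchSwinnertonDyer.Theorems.ErratumRoadFiveNonSurjCornerTwinKato

/-!
# Route `ErratumRoadFive` (rung K2a), crux 6 `NonSurjCorner` (item 19065): the twin summand is μ-DEEP —
# x11c's typed divisibility `X11b.MultDivisibilityAt` = (divisibility in `Λ[1/p]` with `ϖ·L_p ∈ Λ`) +
# (`μ(X(E/ℚ_∞)) = 0`), by the primality of `(p) ⊂ ℤ_p⟦T⟧`
# (cell `bsd-stepL`, seat `bsd-stepL-corner-p1` g4; `--supports stmt-BirchSwinnertonDyer-19065`)

Companion of `ErratumRoadFiveNonSurjCornerTwinKato{Engine,}.lean` (p453738 ∕ p454452): there the corner's rank-`0`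
twin input was shrunk to x11c's typed missing input `X11b.MultDivisibilityAt Wd p` (INTEGRAL cyclotomic
divisibility at the pair: `X` torsion and `ϖ·L = ι(h)` resp. `= ι(T·h)` for some `h ∈ char_Λ X`). THIS FILE
splits that input into its two printed-shaped layers, in the kernel:

* §1 `mem_charIdeal_of_C_pow_mul_mem_of_hasUnitContent` — Λ-algebra: if `char_Λ X = (g)` with `μ(g) = 0`
  (`HasUnitContent g`, Greenberg–Vatsal's reading (2)) and `p^n · Lᵢ ∈ char_Λ X`, then `Lᵢ ∈ char_Λ X` — `(p)` is
  a prime of `Λ = ℤ_p⟦T⟧` (tree theorem `IwasawaAlgebra.isPrime_augIdealP_holds`, Washington §13.1) not dividing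
  `g` (`hasUnitContent_iff_not_C_dvd`), so `p^n ∣ g·k` forces `p^n ∣ k` (`Prime.pow_dvd_of_dvd_mul_left`).
* §2 **`multDivisibilityAt_of_rationalDivisibility_of_mu_eq_zero`** — at any pair `(W, p)`:
  [RATIONAL divisibility with integrality: for all cyclotomic data, `X` torsion and, for THE Mazur–Tate–
  Teitelbaum function `L`, some `Lᵢ ∈ Λ` with `ι(Lᵢ) = ϖ·L` (resp. `ι(T·Lᵢ) = ϖ·L` at a split prime) and
  `p^n · Lᵢ ∈ char_Λ X` for some `n` — the shape of Kato's Thm. 12.5 (3) ∕ 17.4 (2) read at `p ∥ N` (length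
  inequality at the height-one primes `𝔭 ∌ p`; printed as a Selmer-group statement only where an integral
  divisibility is: Wuthrich 2014 Thm. 3 ∕ 16, Cor. 19, Skinner 2016 Thm. A)] + [`μ(X(E/ℚ_∞)) = 0` for every
  cyclotomic dual datum — Greenberg's Conj. 1.11 at the pair, the conclusion shape of rung K6's crux
  `Rank1Residual.KatoMuTransfer` (typed at GOOD ordinary `p`; μ-transfer without `τ`)] ⟹
  `X11b.MultDivisibilityAt W p`. Conversely (`rationalDivisibility_of_multDivisibilityAt`, `n = 0`) the first
  layer is implied by the typed divisibility, so the split loses nothing on that side.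
* §3 **`erratumRoadFive_nonSurjCorner_of_certificates_of_lowerX11a_of_twinRational_of_twinMuZero : pubs →
  EulerHalfOffLocus → X11aLowerHalf → Zₚᶜ → (∀ leaf twins: rational divisibility with integrality) → (∀ leaf
  twins, ∀ cyclotomic D: D.mu = 0) → NonSurjCorner`** — p454452's
  `erratumRoadFive_nonSurjCorner_of_certificates_of_lowerX11a_of_twinMultDivisibility` with `hdiv` supplied
  by §2.

READING (for the planner ∕ rung K6). On the non-surjective X11a leaf (the corner's twins) the Euler-system half
is exactly: a `p ∥ N` version of Kato's divisibility in `Λ[1/p]` (any image) + `μ = 0`. The second is the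
object of rung K6 (`KatoMuTransfer`: `μ(L_p) = 0 ⟹ μ(X) = 0` without `τ`, stated there at good ordinary `p`;
its multiplicative twin would discharge `hμ` below from the lane's per-pair certificate `X11a.MuAnZeroAt`),
so the corner's twin summand is the multiplicative analogue of K6's deciding crux composed with a finite
certificate — NOT Mazur's full main conjecture and NOT the Skinner–Urban ∕ λ-side (that side enters only
through crux 19064 `X11aLowerHalf`).

HONEST FRAMING. Theorems only (no `def`, no named fact minted); every input of §3 beyond print is a
hypothesis SHAPE; nothing here proves the rational divisibility or `μ = 0` at any pair; item 19065 does NOT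
close; no census word moves; BSD is not proved by any of this. Flag `Cha05-Rmk25-structure` rides on §3.

References: [Kato2004Asterisque] Thm. 12.5 (3), Thm. 17.4, Thm. 18.4; [Wuthrich2014] Thm. 3, Thm. 16, Cor. 19
and p. 399; [GreenbergVatsal2000] p. 2 (1)–(2); [GreenbergLNM1716] Conj. 1.11; [Washington1997] §13.1;
[Skinner2016PacificMC] Thm. A (shape); [Miller2011LMS] Def. 1.1; tree: `IwasawaAlgebraProofs.lean`,
`GreenbergVatsal2000/CongruentCurves.lean`, `X11b/MultiplicativeDivisibility.lean`,
`Theorems/Rank1ResidualX9MuTransfer.lean` (K6), g0–g4's `Theorems/ErratumRoadFiveNonSurjCorner*.lean`.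
-/

noncomputable section

open scoped Classical NumberField MatrixGroups ModularForm

namespace Summit.BirchSwinnertonDyer.Rank1Residual.X11b

open CongruenceSubgroup WeierstrassCurve NumberField IsDedekindDomain Field
  Literature.NumberTheory.EllipticCurves
  Literature.NumberTheory.EllipticCurves.ModularForms
  Literature.NumberTheory.EllipticCurves.Rank1Residual
  Literature.NumberTheory.EllipticCurves.Rank1Residual.Typed
  Literature.NumberTheory.EllipticCurves.Wuthrich2014
  Literature.NumberTheory.EllipticCurves.SteinWuthrich2013
  Literature.NumberTheory.EllipticCurves.GreenbergVatsal2000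
  Literature.NumberTheory.EllipticCurves.EmertonPollackWeston2006
  Literature.NumberTheory.QuadraticFields.Quadratic
  Summit.BirchSwinnertonDyer.Rank1Residual
  Summit.BirchSwinnertonDyer.Rank1Residual.X11b.Three.Koly

/-! ### §1 Λ-algebra: `μ(g) = 0` lets powers of `p` be cancelled against `(g)` -/

/-- **`(p)` is prime in `Λ = ℤ_p⟦T⟧` and does not divide a series of unit content**, hence: if `g` has unit
content (`μ(g) = 0`) and `C(p)^n · Lᵢ ∈ (g)`, then `Lᵢ ∈ (g)`. (`Λ/(p) = 𝔽_p⟦T⟧` is a domain —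
`IwasawaAlgebra.isPrime_augIdealP_holds`; `HasUnitContent g ↔ ¬ C(p) ∣ g`; `Prime.pow_dvd_of_dvd_mul_left`.)
[cite: Washington1997, §13.1] [cite: GreenbergVatsal2000, p. 2, (2)] -/
theorem mem_span_of_C_pow_mul_mem_of_hasUnitContent {p : ℕ} [Fact p.Prime] {g Li : IwasawaAlgebra p}
    (hg : HasUnitContent g) (n : ℕ)
    (hmem : PowerSeries.C ((p : ℤ_[p]) ^ n) * Li ∈ Ideal.span ({g} : Set (IwasawaAlgebra p))) :
    Li ∈ Ideal.span ({g} : Set (IwasawaAlgebra p)) := by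
  have hC0 : (PowerSeries.C (p : ℤ_[p]) : IwasawaAlgebra p) ≠ 0 := by
    intro h
    rw [← map_zero PowerSeries.C, PowerSeries.C_injective.eq_iff] at h
    exact (Fact.out : p.Prime).ne_zero (by exact_mod_cast h)
  have hprime : Prime (PowerSeries.C (p : ℤ_[p]) : IwasawaAlgebra p) :=
    (Ideal.span_singleton_prime hC0).mp (IwasawaAlgebra.isPrime_augIdealP_holds p)
  have hndvd : ¬ PowerSeries.C (p : ℤ_[p]) ∣ g := (hasUnitContent_iff_not_C_dvd g).mp hg
  rw [Ideal.mem_span_singleton] at hmem ⊢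
  rw [map_pow] at hmem
  obtain ⟨k, hk⟩ := hmem
  -- `(C p)^n ∣ g * k`, and `C p ∤ g`, so `(C p)^n ∣ k`
  have h1 : (PowerSeries.C (p : ℤ_[p]) : IwasawaAlgebra p) ^ n ∣ g * k := ⟨Li, by rw [← hk]⟩
  obtain ⟨k', hk'⟩ := hprime.pow_dvd_of_dvd_mul_left n hndvd h1
  refine ⟨k', ?_⟩
  have hne : (PowerSeries.C (p : ℤ_[p]) : IwasawaAlgebra p) ^ n ≠ 0 := pow_ne_zero _ hprime.ne_zero
  apply mul_left_cancel₀ hne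
  rw [hk, hk']
  ring

/-- The same for the characteristic ideal of a torsion cyclotomic Selmer dual with `μ = 0`: `p^n · Lᵢ ∈ char_Λ X`
implies `Lᵢ ∈ char_Λ X` (`char_Λ X` is principal, `charIdeal_isPrincipal_holds`; `μ(X) = 0 ↔` unit content of a
generator, `GreenbergVatsal2000.mu_eq_zero_iff_hasUnitContent`). [cite: GreenbergVatsal2000, p. 2, (1)–(2)]
[cite: Washington1997, §13.1–13.2] -/
theorem mem_charIdeal_of_C_pow_mul_mem_of_mu_eq_zero {p : ℕ} [Fact p.Prime]
    {W : WeierstrassCurve ℚ} [W.IsElliptic] {κ : ZpExtension ℚ p} {γ : Field.absoluteGaloisGroup ℚ}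
    (hγ : κ.IsTopGenerator γ) (D : W.SelmerDualData κ γ) (hX : D.IsTorsion) (hμ : D.mu = 0)
    (n : ℕ) {Li : IwasawaAlgebra p} (hmem : PowerSeries.C ((p : ℤ_[p]) ^ n) * Li ∈ D.charIdeal) :
    Li ∈ D.charIdeal := by
  haveI : Module.Finite (IwasawaAlgebra p) D.X := D.module_finite_holds hγ
  obtain ⟨g, hg⟩ := (charIdeal_isPrincipal_holds p D.X).principal
  have hchar : D.charIdeal = Ideal.span {g} := hg
  have hgU : HasUnitContent g := (GreenbergVatsal2000.mu_eq_zero_iff_hasUnitContent D hX hchar).mp hμ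
  rw [hchar] at hmem ⊢
  exact mem_span_of_C_pow_mul_mem_of_hasUnitContent hgU n hmem

/-! ### §2 The typed divisibility = rational divisibility (with integrality) + `μ = 0` -/

/-- **x11c's typed divisibility at the pair from its two layers.** At any `(W, p)`: the RATIONAL divisibility
with integrality (`hrat`: for all cyclotomic data `(κ, γ)`, newforms `f`, dual data `D` and period ratios
`ϖ ≠ 0`, `X` is `Λ`-torsion and THE Mazur–Tate–Teitelbaum function satisfies `ϖ·L = ι(Lᵢ)` (non-split) resp.
`ϖ·L = ι(T·Lᵢ)` (split) with `p^n·Lᵢ ∈ char_Λ X` for some `n` — Kato's Thm. 12.5 (3) ∕ 17.4 (2)-shaped input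
at `p ∥ N`, a hypothesis SHAPE) and `μ(X(E/ℚ_∞)) = 0` for every cyclotomic dual datum (`hμ`: Greenberg's
Conj. 1.11 at the pair; the conclusion shape of rung K6's `KatoMuTransfer`) give `MultDivisibilityAt W p`.
[cite: Kato2004Asterisque, Thm. 12.5 (3) (p. 222) and Thm. 17.4 (2) (p. 273) (shape only)]
[cite: GreenbergLNM1716, §1 Conj. 1.11 (shape only)] [cite: GreenbergVatsal2000, p. 2, (1)–(2)]
[cite: Wuthrich2014, Thm. 3 (p. 383) (shape of the conclusion)] -/
theorem multDivisibilityAt_of_rationalDivisibility_of_mu_eq_zero (W : WeierstrassCurve ℚ) [W.IsElliptic]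
    [W.IsGloballyMinimal] (p : ℕ) [Fact p.Prime]
    (hrat : ∀ {κ : ZpExtension ℚ p} {γ : Field.absoluteGaloisGroup ℚ} {N : ℕ} [NeZero N]
      {f : CuspForm (Gamma0 N) 2},
      κ.IsCyclotomic → κ.IsTopGenerator γ → IsCyclotomicVariable p γ → IsNewformOf W f →
      ∀ (D : W.SelmerDualData κ γ) (ϖ : ℚ), ϖ ≠ 0 → (ϖ : ℝ) * W.realPeriodRat = plusPeriod f →
        D.IsTorsion ∧
        (¬ W.HasSplitMultiplicativeReductionAtPrime p →
          ∀ L : PowerSeries ℚ_[p], IsMultPAdicLFunctionOf f p (-1) L →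
            ∃ (n : ℕ) (Li : IwasawaAlgebra p),
              iwasawaToPowerSeries p Li = PowerSeries.C ((ϖ : ℚ) : ℚ_[p]) * L ∧
              PowerSeries.C ((p : ℤ_[p]) ^ n) * Li ∈ D.charIdeal) ∧
        (W.HasSplitMultiplicativeReductionAtPrime p →
          ∀ L : PowerSeries ℚ_[p], IsSplitMultPAdicLFunctionOf f p L →
            ∃ (n : ℕ) (Li : IwasawaAlgebra p),
              iwasawaToPowerSeries p ((PowerSeries.X : IwasawaAlgebra p) * Li) =
                PowerSeries.C ((ϖ : ℚ) : ℚ_[p]) * L ∧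
              PowerSeries.C ((p : ℤ_[p]) ^ n) * Li ∈ D.charIdeal))
    (hμ : ∀ (κ : ZpExtension ℚ p) (γ : Field.absoluteGaloisGroup ℚ),
      κ.IsCyclotomic → κ.IsTopGenerator γ → IsCyclotomicVariable p γ →
      ∀ D : W.SelmerDualData κ γ, D.mu = 0) :
    MultDivisibilityAt W p := by
  intro κ γ N _ f hκ hγ hγ' hf D ϖ hϖ0 hϖ
  obtain ⟨hX, hns, hs⟩ := hrat hκ hγ hγ' hf D ϖ hϖ0 hϖ
  have hμD : D.mu = 0 := hμ κ γ hκ hγ hγ' D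
  refine ⟨hX, fun hn L hL => ?_, fun hsp L hL => ?_⟩
  · obtain ⟨n, Li, hι, hmem⟩ := hns hn L hL
    exact ⟨Li, mem_charIdeal_of_C_pow_mul_mem_of_mu_eq_zero hγ D hX hμD n hmem, hι⟩
  · obtain ⟨n, Li, hι, hmem⟩ := hs hsp L hL
    exact ⟨Li, mem_charIdeal_of_C_pow_mul_mem_of_mu_eq_zero hγ D hX hμD n hmem, hι⟩

/-- **Conversely, the typed divisibility gives the rational layer (with `n = 0`)** — so §2's split is exact
on the divisibility side; what it isolates is `μ = 0`. [folklore] -/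
theorem rationalDivisibility_of_multDivisibilityAt (W : WeierstrassCurve ℚ) [W.IsElliptic]
    [W.IsGloballyMinimal] (p : ℕ) [Fact p.Prime] (hdiv : MultDivisibilityAt W p)
    {κ : ZpExtension ℚ p} {γ : Field.absoluteGaloisGroup ℚ} {N : ℕ} [NeZero N]
    {f : CuspForm (Gamma0 N) 2}
    (hκ : κ.IsCyclotomic) (hγ : κ.IsTopGenerator γ) (hγ' : IsCyclotomicVariable p γ) (hf : IsNewformOf W f)
    (D : W.SelmerDualData κ γ) (ϖ : ℚ) (hϖ0 : ϖ ≠ 0) (hϖ : (ϖ : ℝ) * W.realPeriodRat = plusPeriod f) :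
    D.IsTorsion ∧
      (¬ W.HasSplitMultiplicativeReductionAtPrime p →
        ∀ L : PowerSeries ℚ_[p], IsMultPAdicLFunctionOf f p (-1) L →
          ∃ (n : ℕ) (Li : IwasawaAlgebra p),
            iwasawaToPowerSeries p Li = PowerSeries.C ((ϖ : ℚ) : ℚ_[p]) * L ∧
            PowerSeries.C ((p : ℤ_[p]) ^ n) * Li ∈ D.charIdeal) ∧
      (W.HasSplitMultiplicativeReductionAtPrime p →
        ∀ L : PowerSeries ℚ_[p], IsSplitMultPAdicLFunctionOf f p L →
          ∃ (n : ℕ) (Li : IwasawaAlgebra p),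
            iwasawaToPowerSeries p ((PowerSeries.X : IwasawaAlgebra p) * Li) =
              PowerSeries.C ((ϖ : ℚ) : ℚ_[p]) * L ∧
            PowerSeries.C ((p : ℤ_[p]) ^ n) * Li ∈ D.charIdeal) := by
  obtain ⟨hX, hns, hs⟩ := hdiv hκ hγ hγ' hf D ϖ hϖ0 hϖ
  refine ⟨hX, fun hn L hL => ?_, fun hsp L hL => ?_⟩
  · obtain ⟨g, hg, hι⟩ := hns hn L hL
    exact ⟨0, g, hι, by rw [pow_zero, map_one, one_mul]; exact hg⟩
  · obtain ⟨g, hg, hι⟩ := hs hsp L hL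
    exact ⟨0, g, hι, by rw [pow_zero, map_one, one_mul]; exact hg⟩

/-! ### §3 The corner with the twin summand in two layers: rational divisibility + `μ = 0` on the leaf twins -/

/-- **`NonSurjCorner` modulo print + EulerHalfOffLocus (19062) + X11aLowerHalf (19064) + Zₚᶜ + [rational
divisibility with integrality on the leaf twins] + [`μ(X(E^d/ℚ_∞)) = 0` on the leaf twins]** — p454452's
`erratumRoadFive_nonSurjCorner_of_certificates_of_lowerX11a_of_twinMultDivisibility` with its binder `hdiv`
(x11c's typed divisibility on the non-surjective X11a leaf at `p ∈ {5,7}`) SPLIT by §2 into `hrat` (Kato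
12.5 (3)-shaped, `Λ[1/p]`) and `hμ` (Greenberg's `μ = 0` at the twin pairs — rung K6's object). PUBLISHED
binders as there. CONDITIONAL on `h₂`, `h₄`, `hZ`, `hrat`, `hμ`; does NOT close item 19065; nothing booked.
[cite: Kato2004Asterisque, Thm. 12.5 (3) (p. 222) (shape only)] [cite: GreenbergLNM1716, §1 Conj. 1.11 (shape only)]
[cite: Cha2005, Rmk. 25 (p. 175)] [cite: MatarNekovar2019, Thm. 0.3, §0.9, §0.11 (pp. 456–457)]
[cite: WZhang2014, Thm. 1.1 and Rem. 5 (shape of Zₚᶜ)] [cite: SteinWuthrich2013, Thm. 6.1 (p. 20)]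
[cite: JetchevSkinnerWan2017, §7.4.1–7.4.2 (pp. 30–31)] [cite: Miller2011LMS, Def. 1.1] -/
theorem erratumRoadFive_nonSurjCorner_of_certificates_of_lowerX11a_of_twinRational_of_twinMuZero
    (hGZ : ∀ (N : ℕ) [NeZero N] (W : WeierstrassCurve ℚ) (K : Type) [Field K] [NumberField K],
      gross_zagier N W K)
    (hKo : ∀ (N : ℕ) [NeZero N] (W : WeierstrassCurve ℚ) (K : Type) [Field K] [NumberField K],
      kolyvagin N W K)
    (hWu : sha_dvd_analyticSha)
    (hMN : ∀ (N : ℕ) [NeZero N] (W : WeierstrassCurve ℚ) (K : Type) [Field K] [NumberField K],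
      MatarNekovar2019.thm03_padicValNat_card_sha_le_of_irreducible N W K)
    (hGZK : rank_eq_analyticRank_of_analyticRank_le_one) (hmod : hasEntireLFunction_rat)
    (hnf : exists_isNewformOf) (hpar : nonempty_modularParametrizationData)
    (hFHs : friedbergHoffstein_exists_heegnerField_split_twist_ne_zero)
    (hMaz : mazur_not_dvd_maninConstant_of_odd)
    (hrec : ∀ (N : ℕ) [NeZero N] (W : WeierstrassCurve ℚ) (K : Type) [Field K] [NumberField K],
      heegnerPointOfConductor_one_galoisConj N W K)
    (hD36 : ∀ (N : ℕ) [NeZero N] (W : WeierstrassCurve ℚ) (K : Type) [Field K] [NumberField K],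
      phi_heegnerTau_mem_singularModuliField N W K)
    (hJs : thm61_splitMultiplicative) (hJn : thm61_nonsplitMultiplicative)
    (hGS : ∀ (W : WeierstrassCurve ℚ) [W.IsElliptic] [W.IsGloballyMinimal] (p : ℕ) [Fact p.Prime],
      greenberg_stevens (W := W) (p := p))
    (hChaL : Cha2005.rmk25_pow_dvd_card_sha_primary_of_certificate)
    (h₂ : Summit.BirchSwinnertonDyer.BirchSwinnertonDyer.Theses.ErratumRoadFive.EulerHalfOffLocus)
    (h₄ : Summit.BirchSwinnertonDyer.BirchSwinnertonDyer.Theses.ErratumRoadFive.X11aLowerHalf)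
    -- Zₚᶜ: certificates on corner frames (`M_∞ ≤ t`)
    (hZ : ∀ (W : WeierstrassCurve ℚ) [W.IsElliptic] [W.IsGloballyMinimal] (p : ℕ) [Fact p.Prime]
      (N : ℕ) [NeZero N] (K : Type) [Field K] [NumberField K]
      (Dt : ModularParametrizationData W N) (β : ℤ) (ι : K →+* ℂ),
      ClassX11b W p → ¬ Surj W p → (p = 5 ∨ p = 7) → p ∣ padicValInt p W.minimalDiscriminantInt →
      ¬ Ram W p → W.conductorNorm ℤ = N → IsImaginaryQuadratic K →
      4 < (NumberField.discr K).natAbs → SatisfiesHeegnerHypothesis N K →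
      SatisfiesHeegnerHypothesis p K → (4 * (N : ℤ)) ∣ β ^ 2 - NumberField.discr K → ¬ (p : ℤ) ∣ Dt.c →
      ∃ M : ℕ, M ≤ padicValNat p W.tamagawaProduct ∧ CertificateAt Dt β ι p M)
    -- layer 1 on the leaf twins: divisibility in Λ[1/p] with ϖ·L_p ∈ Λ (Kato 12.5 (3)-shaped; hypothesis shape)
    (hrat : ∀ (Wd : WeierstrassCurve ℚ) [Wd.IsElliptic] [Wd.IsGloballyMinimal] (p : ℕ) [Fact p.Prime],
      ClassX11a Wd p → ¬ Surj Wd p → (p = 5 ∨ p = 7) → p ∣ padicValInt p Wd.minimalDiscriminantInt →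
      ∀ {κ : ZpExtension ℚ p} {γ : Field.absoluteGaloisGroup ℚ} {N : ℕ} [NeZero N]
        {f : CuspForm (Gamma0 N) 2},
        κ.IsCyclotomic → κ.IsTopGenerator γ → IsCyclotomicVariable p γ → IsNewformOf Wd f →
        ∀ (D : Wd.SelmerDualData κ γ) (ϖ : ℚ), ϖ ≠ 0 → (ϖ : ℝ) * Wd.realPeriodRat = plusPeriod f →
          D.IsTorsion ∧
          (¬ Wd.HasSplitMultiplicativeReductionAtPrime p →
            ∀ L : PowerSeries ℚ_[p], IsMultPAdicLFunctionOf f p (-1) L →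
              ∃ (n : ℕ) (Li : IwasawaAlgebra p),
                iwasawaToPowerSeries p Li = PowerSeries.C ((ϖ : ℚ) : ℚ_[p]) * L ∧
                PowerSeries.C ((p : ℤ_[p]) ^ n) * Li ∈ D.charIdeal) ∧
          (Wd.HasSplitMultiplicativeReductionAtPrime p →
            ∀ L : PowerSeries ℚ_[p], IsSplitMultPAdicLFunctionOf f p L →
              ∃ (n : ℕ) (Li : IwasawaAlgebra p),
                iwasawaToPowerSeries p ((PowerSeries.X : IwasawaAlgebra p) * Li) =
                  PowerSeries.C ((ϖ : ℚ) : ℚ_[p]) * L ∧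
                PowerSeries.C ((p : ℤ_[p]) ^ n) * Li ∈ D.charIdeal))
    -- layer 2 on the leaf twins: Greenberg's μ = 0 at the twin pair (rung K6's object; hypothesis shape)
    (hμ : ∀ (Wd : WeierstrassCurve ℚ) [Wd.IsElliptic] [Wd.IsGloballyMinimal] (p : ℕ) [Fact p.Prime],
      ClassX11a Wd p → ¬ Surj Wd p → (p = 5 ∨ p = 7) → p ∣ padicValInt p Wd.minimalDiscriminantInt →
      ∀ (κ : ZpExtension ℚ p) (γ : Field.absoluteGaloisGroup ℚ),
        κ.IsCyclotomic → κ.IsTopGenerator γ → IsCyclotomicVariable p γ →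
        ∀ D : Wd.SelmerDualData κ γ, D.mu = 0) :
    Summit.BirchSwinnertonDyer.BirchSwinnertonDyer.Theses.ErratumRoadFive.NonSurjCorner :=
  erratumRoadFive_nonSurjCorner_of_certificates_of_lowerX11a_of_twinMultDivisibility hGZ hKo hWu hMN hGZK
    hmod hnf hpar hFHs hMaz hrec hD36 hJs hJn hGS hChaL h₂ h₄ hZ
    (fun Wd _ _ p _ hXa hnsd h57 hvd ↦
      multDivisibilityAt_of_rationalDivisibility_of_mu_eq_zero Wd p
        (fun hκ hγ hγ' hf D ϖ hϖ0 hϖ ↦ hrat Wd p hXa hnsd h57 hvd hκ hγ hγ' hf D ϖ hϖ0 hϖ)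
        (hμ Wd p hXa hnsd h57 hvd))

end Summit.BirchSwinnertonDyer.Rank1Residual.X11b

end
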